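import Summits.CriticalPhenomena.PercolationContinuityZ3.Theorems.PercNearOneGluingNoHeavyLowerTailSahiGridPatternZeroLocusIndep
import Summits.CriticalPhenomena.PercolationContinuityZ3.Theorems.PercNearOneGluingNoHeavyLowerTailSahiGridPatternZeroLocusShadow

/-!
# `NoHeavyLowerTail` (crux stmt-CriticalPhenomena-4575), Sahi programme P1: Boolean shadow of the equality theorems —
# **the Ahlswede–Daykin slack `top(𝒰∩𝒱) − dee(𝒰,𝒱)` of two up-families vanishes iff they are independent**

Support file (Sahi cell, seat `prim-sahi-p1`, generation 14; `--supports stmt-CriticalPhenomena-4575`).  Pure proofs, no definitions, no `sorry`,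
standard axioms.  Transfer of `sStarD_univ_eq_zero_iff` (…ZeroLocusIndep) along the shadow bridge `sStarD_shadow_eq` (…ShadowTPP): for UP-families
`𝒰, 𝒱 ⊆ 𝒫([d])`, the three-partition functional with a trivial third family, `threePartN 𝒰 𝒱 ⊤` (which equals `top(𝒰∩𝒱) − dee(𝒱,𝒰)`: the number of
ordered 3-partitions with `S₃ ∈ 𝒰 ∩ 𝒱` minus the number with `S₁ ∈ 𝒱, S₃ ∈ 𝒰` — nonnegative by Kleitman–Harris on every fibre, cf. `threePartN_univ_nonneg` of
`…ThreePartitionAD` for the symmetric slot), VANISHES iff membership in `𝒰` depends only on `S ∩ I` and membership in `𝒱` only on `S ∖ I` for some block `I`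
(`threePartN_univ_eq_zero_iff`); and on the independent-pair face of three-partition positivity the zero locus is exactly the saturated family
(`threePartN_eq_zero_iff_saturated_of_indep`, transfer of `sStarD_eq_zero_iff_saturated_of_indepSlots`).  HONEST LABEL: equality cases only; three-partition positivity, `PatternPos d` (`d ≥ 5`), Sahi's `C₃` and
Kahn's conjecture remain OPEN. [this work]
-/

noncomputable section

open Finset
open scoped Classical

namespace Summit.CriticalPhenomena.PercolationContinuityZ3.Theorems.SahiGridPattern

open Summit.CriticalPhenomena.PercolationContinuityZ3.Theorems.ThreePartition

variable {d : ℕ}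

/-- The `{0,2}`-point of a set: `χ_S(a) = 2` if `a ∈ S`, else `0`; its 2-set is `S`. [this work] -/
theorem twoSet_indicator (S : Set (Fin d)) : {a : Fin d | (fun a => if a ∈ S then (2 : Fin 3) else 0) a = 2} = S := by
  ext a
  simp only [Set.mem_setOf_eq]
  by_cases h : a ∈ S
  · rw [if_pos h]; exact ⟨fun _ => h, fun _ => rfl⟩
  · rw [if_neg h]; exact ⟨fun h0 => absurd h0 (by decide), fun ha => absurd ha h⟩

/-- Block measurability passes from the shadow up-set of `[3]^d` to the family. [this work] -/
theorem family_meas_of_shadow_meas {𝒰 : Set (Set (Fin d))} {P : Fin d → Prop}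
    (h : ∀ x y : Pd d, (∀ a, P a → x a = y a) →
      (x ∈ (univ.filter fun x : Pd d => {a : Fin d | x a = 2} ∈ 𝒰) ↔ y ∈ (univ.filter fun x : Pd d => {a : Fin d | x a = 2} ∈ 𝒰))) :
    ∀ S T : Set (Fin d), (∀ a, P a → (a ∈ S ↔ a ∈ T)) → (S ∈ 𝒰 ↔ T ∈ 𝒰) := by
  intro S T hST
  have key := h (fun a => if a ∈ S then (2 : Fin 3) else 0) (fun a => if a ∈ T then (2 : Fin 3) else 0) (fun a ha => by
    show (if a ∈ S then (2 : Fin 3) else 0) = (if a ∈ T then (2 : Fin 3) else 0)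
    by_cases hS : a ∈ S
    · rw [if_pos hS, if_pos ((hST a ha).1 hS)]
    · rw [if_neg hS, if_neg (fun hT => hS ((hST a ha).2 hT))])
  simp only [Finset.mem_filter, Finset.mem_univ, true_and] at key
  rw [twoSet_indicator S, twoSet_indicator T] at key
  exact key

/-- **THE AHLSWEDE–DAYKIN / KLEITMAN–HARRIS SLACK OF TWO UP-FAMILIES VANISHES IFF THEY ARE INDEPENDENT** (every `d`): for up-families `𝒰, 𝒱`,
`threePartN 𝒰 𝒱 ⊤ = 0` iff for some block `I` membership in `𝒰` depends only on `S ∩ I` and membership in `𝒱` only on `S ∖ I`. [this work] -/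
theorem threePartN_univ_eq_zero_iff {𝒰 𝒱 : Set (Set (Fin d))} (h𝒰 : IsUpperSet 𝒰) (h𝒱 : IsUpperSet 𝒱) :
    threePartN 𝒰 𝒱 (Set.univ : Set (Set (Fin d))) = 0 ↔
      ∃ I : Finset (Fin d), (∀ S T : Set (Fin d), (∀ a ∈ I, (a ∈ S ↔ a ∈ T)) → (S ∈ 𝒰 ↔ T ∈ 𝒰)) ∧
        (∀ S T : Set (Fin d), (∀ a ∉ I, (a ∈ S ↔ a ∈ T)) → (S ∈ 𝒱 ↔ T ∈ 𝒱)) := by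
  have hbridge := sStarD_shadow_eq 𝒰 𝒱 (Set.univ : Set (Set (Fin d)))
    (A := univ.filter fun x : Pd d => {a : Fin d | x a = 2} ∈ 𝒰)
    (B := univ.filter fun x : Pd d => {a : Fin d | x a = 2} ∈ 𝒱) (C := (univ : Finset (Pd d)))
    (fun x => by simp) (fun x => by simp) (fun x => by simp)
  have hiff := sStarD_univ_eq_zero_iff (isUpperSet_shadow h𝒰) (isUpperSet_shadow h𝒱)
  rw [hbridge] at hiff
  have h2 : (2 : ℤ) ^ d ≠ 0 := pow_ne_zero _ (by norm_num)
  rw [mul_eq_zero, or_iff_right h2] at hiff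
  rw [hiff]
  constructor
  · rintro ⟨I, hA, hB⟩
    exact ⟨I, family_meas_of_shadow_meas (P := fun a => a ∈ I) (fun x y h => hA x y h),
      family_meas_of_shadow_meas (P := fun a => a ∉ I) (fun x y h => hB x y h)⟩
  · rintro ⟨I, hU, hV⟩
    refine ⟨I, fun x y hxy => ?_, fun x y hxy => ?_⟩
    · rw [Finset.mem_filter, Finset.mem_filter]
      simp only [Finset.mem_univ, true_and]
      exact hU _ _ fun a ha => by simp [hxy a ha]
    · rw [Finset.mem_filter, Finset.mem_filter]
      simp only [Finset.mem_univ, true_and]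
      exact hV _ _ fun a ha => by simp [hxy a ha]


/-- Block measurability passes from an intersection of shadows to the intersection of the families. [this work] -/
theorem family_meas_of_shadow_meas_inter {𝒱 𝒲 : Set (Set (Fin d))} {P : Fin d → Prop}
    (h : ∀ x y : Pd d, (∀ a, P a → x a = y a) →
      (x ∈ (univ.filter fun x : Pd d => {a : Fin d | x a = 2} ∈ 𝒱) ∩ (univ.filter fun x : Pd d => {a : Fin d | x a = 2} ∈ 𝒲) ↔
        y ∈ (univ.filter fun x : Pd d => {a : Fin d | x a = 2} ∈ 𝒱) ∩ (univ.filter fun x : Pd d => {a : Fin d | x a = 2} ∈ 𝒲))) :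
    ∀ S T : Set (Fin d), (∀ a, P a → (a ∈ S ↔ a ∈ T)) → (S ∈ 𝒱 ∩ 𝒲 ↔ T ∈ 𝒱 ∩ 𝒲) := by
  intro S T hST
  have key := h (fun a => if a ∈ S then (2 : Fin 3) else 0) (fun a => if a ∈ T then (2 : Fin 3) else 0) (fun a ha => by
    show (if a ∈ S then (2 : Fin 3) else 0) = (if a ∈ T then (2 : Fin 3) else 0)
    by_cases hS : a ∈ S
    · rw [if_pos hS, if_pos ((hST a ha).1 hS)]
    · rw [if_neg hS, if_neg (fun hT => hS ((hST a ha).2 hT))])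
  simp only [Finset.mem_inter, Finset.mem_filter, Finset.mem_univ, true_and] at key
  rw [twoSet_indicator S, twoSet_indicator T] at key
  rw [Set.mem_inter_iff, Set.mem_inter_iff]
  exact key

/-- **ON THE INDEPENDENT-PAIR FACE OF THREE-PARTITION POSITIVITY THE ZERO LOCUS IS THE SATURATED FAMILY** (every `d`): for up-families `𝒰` (depends on
`S ∩ I`), `𝒱` (depends on `S ∩ J`, `I ∩ J = ∅`) and an up-family `𝒲`, `threePartN 𝒰 𝒱 𝒲 = 0` iff there are blocks `I'`, `J'` such that `𝒰` depends on `S ∩ I'` and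
membership in `𝒱 ∩ 𝒲` is unchanged by altering a set inside `I'`, and `𝒱` depends on `S ∩ J'` and membership in `𝒰 ∩ 𝒲` is unchanged by altering a set
inside `J'`. [this work] -/
theorem threePartN_eq_zero_iff_saturated_of_indep (I J : Finset (Fin d)) (hIJ : Disjoint I J) {𝒰 𝒱 𝒲 : Set (Set (Fin d))}
    (h𝒰 : IsUpperSet 𝒰) (h𝒱 : IsUpperSet 𝒱) (h𝒲 : IsUpperSet 𝒲)
    (hdep𝒰 : ∀ S T : Set (Fin d), (∀ a ∈ I, (a ∈ S ↔ a ∈ T)) → (S ∈ 𝒰 ↔ T ∈ 𝒰))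
    (hdep𝒱 : ∀ S T : Set (Fin d), (∀ a ∈ J, (a ∈ S ↔ a ∈ T)) → (S ∈ 𝒱 ↔ T ∈ 𝒱)) :
    threePartN 𝒰 𝒱 𝒲 = 0 ↔
      ((∃ I' : Finset (Fin d), (∀ S T : Set (Fin d), (∀ a ∈ I', (a ∈ S ↔ a ∈ T)) → (S ∈ 𝒰 ↔ T ∈ 𝒰)) ∧
          (∀ S T : Set (Fin d), (∀ a ∉ I', (a ∈ S ↔ a ∈ T)) → (S ∈ 𝒱 ∩ 𝒲 ↔ T ∈ 𝒱 ∩ 𝒲))) ∧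
       (∃ J' : Finset (Fin d), (∀ S T : Set (Fin d), (∀ a ∈ J', (a ∈ S ↔ a ∈ T)) → (S ∈ 𝒱 ↔ T ∈ 𝒱)) ∧
          (∀ S T : Set (Fin d), (∀ a ∉ J', (a ∈ S ↔ a ∈ T)) → (S ∈ 𝒰 ∩ 𝒲 ↔ T ∈ 𝒰 ∩ 𝒲)))) := by
  have hbridge := sStarD_shadow_eq 𝒰 𝒱 𝒲
    (A := univ.filter fun x : Pd d => {a : Fin d | x a = 2} ∈ 𝒰)
    (B := univ.filter fun x : Pd d => {a : Fin d | x a = 2} ∈ 𝒱)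
    (C := univ.filter fun x : Pd d => {a : Fin d | x a = 2} ∈ 𝒲)
    (fun x => by simp) (fun x => by simp) (fun x => by simp)
  have hiff := sStarD_eq_zero_iff_saturated_of_indepSlots I J hIJ (isUpperSet_shadow h𝒰) (isUpperSet_shadow h𝒱) (isUpperSet_shadow h𝒲)
    (fun x y hxy => by
      rw [Finset.mem_filter, Finset.mem_filter]
      simp only [Finset.mem_univ, true_and]
      exact hdep𝒰 _ _ fun a ha => by simp [hxy a ha])
    (fun x y hxy => by
      rw [Finset.mem_filter, Finset.mem_filter]
      simp only [Finset.mem_univ, true_and]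
      exact hdep𝒱 _ _ fun a ha => by simp [hxy a ha])
  rw [hbridge] at hiff
  have h2 : (2 : ℤ) ^ d ≠ 0 := pow_ne_zero _ (by norm_num)
  rw [mul_eq_zero, or_iff_right h2] at hiff
  rw [hiff]
  constructor
  · rintro ⟨⟨I', hA, hBC⟩, ⟨J', hB, hAC⟩⟩
    exact ⟨⟨I', family_meas_of_shadow_meas (P := fun a => a ∈ I') (fun x y h => hA x y h),
        family_meas_of_shadow_meas_inter (P := fun a => a ∉ I') (fun x y h => hBC x y h)⟩,
      ⟨J', family_meas_of_shadow_meas (P := fun a => a ∈ J') (fun x y h => hB x y h),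
        family_meas_of_shadow_meas_inter (P := fun a => a ∉ J') (fun x y h => hAC x y h)⟩⟩
  · rintro ⟨⟨I', hU, hVW⟩, ⟨J', hV, hUW⟩⟩
    refine ⟨⟨I', fun x y hxy => ?_, fun x y hxy => ?_⟩, ⟨J', fun x y hxy => ?_, fun x y hxy => ?_⟩⟩
    · rw [Finset.mem_filter, Finset.mem_filter]
      simp only [Finset.mem_univ, true_and]
      exact hU _ _ fun a ha => by simp [hxy a ha]
    · simp only [Finset.mem_inter, Finset.mem_filter, Finset.mem_univ, true_and, ← Set.mem_inter_iff]
      exact hVW _ _ fun a ha => by simp [hxy a ha]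
    · rw [Finset.mem_filter, Finset.mem_filter]
      simp only [Finset.mem_univ, true_and]
      exact hV _ _ fun a ha => by simp [hxy a ha]
    · simp only [Finset.mem_inter, Finset.mem_filter, Finset.mem_univ, true_and, ← Set.mem_inter_iff]
      exact hUW _ _ fun a ha => by simp [hxy a ha]

end Summit.CriticalPhenomena.PercolationContinuityZ3.Theorems.SahiGridPattern
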